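import Literature.Probability.Percolation.IsoradialRectangularCrossingsProofs
import Literature.Probability.Percolation.QuadCrossingRotationInvarianceOfTransfer
import HarnessLib

/-!
# DKKMO Theorem 2.1 (`q = 1`) on quad crossings from the printed Theorem 1.7 and a loops-to-crossings transfer

Topic `Probability/Percolation`; proofs-only sequel of `IsoradialRectangularCrossingsProofs.lean`
(no definition, no named fact). The named fact `DKKMO2020_thm21_quadCrossingProb`
(Duminil-Copin–Kozlowski–Krachun–Manolescu–Oulamara, arXiv:2012.11672v1, Thm. 2.1 at `q = 1`,
read on the Schramm–Smirnov crossing event of each quad) has no discharge in the tree. This file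
records, kernel-checked, the exact shape of what is missing between it and the PRINTED universality
theorem: the fact follows from

* `dkkmo_theorem_1_7` (`LoopRepresentation.lean`: v2 Thm. 1.7, the `d_CN` statement, an UNDISCHARGED
  named fact of the tree), and
* a loops-to-crossings transfer `H` on a FIXED quad between a configuration `ω` drawn on `δ𝕃(α)` and
  a configuration `ω'` drawn on `δ𝕃(π/2) = e^{iπ/4}√2 δℤ²` whose typed loop representations are
  `η`-close (`LoopConfig.IsClose η`), with BOTH error events charged to the `ℤ²` side (`G`: robust
  crossings, `B`: robust non-crossings of `ω'`), so that no percolation estimate on `𝕃(α)`,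
  `α ≠ π/2`, is asked for — the `𝕃(α)`-analogue of the hypothesis `H` of
  `dkkmo_crossing_rotation_invariance_of_transfer` (`QuadCrossingRotationInvarianceOfTransfer.lean`;
  not discharged for `ℤ²` either). This is how the paper reads Thm. 2.1 on crossing probabilities
  (§5.2 p. 25: `d_H` controls `d_CN`; §7.1 p. 43: "the measurability of `𝒞(Q)` in the
  Schramm–Smirnov topology").

* `abs_measureReal_sub_le_of_transfer` — the generic two-sided coupling bound with one-sided error
  events;
* `DKKMO2020_thm21_quadCrossingProb_of_transfer : H → dkkmo_theorem_1_7 → DKKMO2020_thm21_quadCrossingProb`.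

Written for the crux `BoxFamilyToCardy` of `CardyFormulaZ2` (stmt-CriticalPhenomena-14215, stub
`stub_dkkmoUniversality`), whose known half rests on exactly this named fact.

## References

* [DKKMO2020Rotational] H. Duminil-Copin, K. K. Kozlowski, D. Krachun, I. Manolescu, M. Oulamara,
  arXiv:2012.11672v1 (2020), Thm. 2.1, §5.2 p. 25, §7.1 p. 43; v2 (2026) Thm. 1.7.
-/

noncomputable section

open MeasureTheory Set
open scoped Real
open Literature.Probability.LatticeModels Literature.Probability.RandomPlanarGeometry

namespace Literature.Probability.Percolation

/-- **Two-sided coupling bound with one-sided error events.** Let `P` couple `μ` and `ν`, let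
`A`, `A'` be measurable, and let `Cl` ("close") be an event of the coupling with
`P(Clᶜ) ≤ e₃`. If on `Cl` membership of the second coordinate in `A' ∩ G` forces the first into
`A`, and membership of the second in `A'ᶜ ∩ B` forces the first out of `A`, then
`|μ(A) - ν(A')| ≤ max ν(A' ∖ G) ν(A'ᶜ ∖ B) + e₃` (union bounds; `G`, `B` need not be
measurable, their marginal events are compared through `Measure.le_map_apply`). [folklore] -/
theorem abs_measureReal_sub_le_of_transfer {X : Type*} [MeasurableSpace X] {μ ν : Measure X}
    [IsFiniteMeasure ν] (P : Measure (X × X)) [IsFiniteMeasure P] (h₁ : P.map Prod.fst = μ)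
    (h₂ : P.map Prod.snd = ν) {A A' : Set X} (hA : MeasurableSet A) (hA' : MeasurableSet A')
    (Cl : Set (X × X)) (G B : Set X) {e₁ e₂ e₃ : ℝ} (hG : ν.real (A' \ G) ≤ e₁)
    (hB : ν.real (A'ᶜ \ B) ≤ e₂) (hCl : P.real Clᶜ ≤ e₃)
    (htr₁ : ∀ p ∈ Cl, p.2 ∈ A' → p.2 ∈ G → p.1 ∈ A)
    (htr₂ : ∀ p ∈ Cl, p.2 ∉ A' → p.2 ∈ B → p.1 ∉ A) :
    |μ.real A - ν.real A'| ≤ max e₁ e₂ + e₃ := by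
  have hPA : P.real (Prod.fst ⁻¹' A) = μ.real A := by
    rw [← h₁, map_measureReal_apply measurable_fst hA]
  have hPA' : P.real (Prod.snd ⁻¹' A') = ν.real A' := by
    rw [← h₂, map_measureReal_apply measurable_snd hA']
  have hPG : P.real (Prod.snd ⁻¹' (A' \ G)) ≤ ν.real (A' \ G) :=
    measureReal_preimage_snd_le_of_map_eq h₂ _
  have hPB : P.real (Prod.snd ⁻¹' (A'ᶜ \ B)) ≤ ν.real (A'ᶜ \ B) :=
    measureReal_preimage_snd_le_of_map_eq h₂ _
  -- upper bound: `{ω ∈ A} ⊆ {ω' ∈ A'} ∪ {ω' ∈ A'ᶜ ∖ B} ∪ Clᶜ`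
  have hup : Prod.fst ⁻¹' A ⊆ (Prod.snd ⁻¹' A' ∪ Prod.snd ⁻¹' (A'ᶜ \ B)) ∪ Clᶜ := by
    rintro ⟨x, y⟩ hx
    by_cases hy : y ∈ A'
    · exact Or.inl (Or.inl hy)
    · by_cases hBy : y ∈ B
      · by_cases hC : (x, y) ∈ Cl
        · exact absurd hx (htr₂ _ hC hy hBy)
        · exact Or.inr hC
      · exact Or.inl (Or.inr ⟨hy, hBy⟩)
  -- lower bound: `{ω' ∈ A'} ⊆ {ω ∈ A} ∪ {ω' ∈ A' ∖ G} ∪ Clᶜ`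
  have hlow : Prod.snd ⁻¹' A' ⊆ (Prod.fst ⁻¹' A ∪ Prod.snd ⁻¹' (A' \ G)) ∪ Clᶜ := by
    rintro ⟨x, y⟩ hy
    by_cases hGy : y ∈ G
    · by_cases hC : (x, y) ∈ Cl
      · exact Or.inl (Or.inl (htr₁ _ hC hy hGy))
      · exact Or.inr hC
    · exact Or.inl (Or.inr ⟨hy, hGy⟩)
  have h1 : P.real (Prod.fst ⁻¹' A) ≤
      P.real (Prod.snd ⁻¹' A') + P.real (Prod.snd ⁻¹' (A'ᶜ \ B)) + P.real Clᶜ :=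
    calc P.real (Prod.fst ⁻¹' A)
        ≤ P.real ((Prod.snd ⁻¹' A' ∪ Prod.snd ⁻¹' (A'ᶜ \ B)) ∪ Clᶜ) := measureReal_mono hup
      _ ≤ P.real (Prod.snd ⁻¹' A' ∪ Prod.snd ⁻¹' (A'ᶜ \ B)) + P.real Clᶜ :=
          measureReal_union_le _ _
      _ ≤ P.real (Prod.snd ⁻¹' A') + P.real (Prod.snd ⁻¹' (A'ᶜ \ B)) + P.real Clᶜ := by
          gcongr
          exact measureReal_union_le _ _
  have h2 : P.real (Prod.snd ⁻¹' A') ≤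
      P.real (Prod.fst ⁻¹' A) + P.real (Prod.snd ⁻¹' (A' \ G)) + P.real Clᶜ :=
    calc P.real (Prod.snd ⁻¹' A')
        ≤ P.real ((Prod.fst ⁻¹' A ∪ Prod.snd ⁻¹' (A' \ G)) ∪ Clᶜ) := measureReal_mono hlow
      _ ≤ P.real (Prod.fst ⁻¹' A ∪ Prod.snd ⁻¹' (A' \ G)) + P.real Clᶜ :=
          measureReal_union_le _ _
      _ ≤ P.real (Prod.fst ⁻¹' A) + P.real (Prod.snd ⁻¹' (A' \ G)) + P.real Clᶜ := by
          gcongr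
          exact measureReal_union_le _ _
  rw [hPA, hPA'] at h1 h2
  have hm1 : e₁ ≤ max e₁ e₂ := le_max_left _ _
  have hm2 : e₂ ≤ max e₁ e₂ := le_max_right _ _
  rw [abs_sub_le_iff]
  constructor <;> linarith

/-- **`DKKMO2020_thm21_quadCrossingProb` from the printed Theorem 1.7 (`d_CN` form) and a
loops-to-crossings transfer on a fixed quad, all error events on the `ℤ²` side.** Suppose (`H`)
that for every quad `R` and `ε > 0` there are a closeness level `η > 0` and `δ₁ > 0` such that
for every angle `α ∈ (0, π)` and mesh `δ ∈ (0, δ₁)` there are events `G`, `B` of the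
`𝕃(π/2)`-configuration (critical bond percolation on `e^{iπ/4}√2 ℤ²`) with
`P_{𝕃(π/2)}[𝒞_δ(Q) ∖ G] ≤ ε`, `P_{𝕃(π/2)}[𝒞_δ(Q)ᶜ ∖ B] ≤ ε` (Schramm–Smirnov continuity (5.1),
window confinement, macroscopic exterior boundary loop — `ℤ²` estimates only), and the two
deterministic transfers: if the typed loop representations of `ω` on `δ𝕃(α)` and of `ω'` on
`δ𝕃(π/2)` are `η`-close (`LoopConfig.IsClose η`), then a `G`-robust crossing of `Q` by `ω'`
forces a crossing of `Q` by `ω` (drawn on `δ𝕃(α)`), and a `B`-robust non-crossing of `Q` by `ω'`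
forbids a crossing by `ω`. Then DKKMO's Theorem 1.7 as printed (`dkkmo_theorem_1_7`: couplings
with `ℙ[¬ (d_CN ≤ C δ^c)] < C δ^c`, uniformly in `α ∈ (0, π)`) implies the per-quad crossing
statement `DKKMO2020_thm21_quadCrossingProb` (with `ε/2` for the two error events,
`C δ^c < min η (ε/2)` below `δ₂`, `δ₀ = min δ₁ δ₂`; `abs_measureReal_sub_le_of_transfer`).
[cite: DKKMO2020Rotational, Thm. 2.1 (q = 1), with §5.2 p. 25 and §7.1 p. 43] -/
theorem DKKMO2020_thm21_quadCrossingProb_of_transfer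
    (H : ∀ (R : ConformalRectangle) (ε : ℝ), 0 < ε → ∃ η : ℝ, 0 < η ∧ ∃ δ₁ : ℝ, 0 < δ₁ ∧
      ∀ α ∈ Set.Ioo (0 : ℝ) π, ∀ δ ∈ Set.Ioo (0 : ℝ) δ₁, ∃ G B : Set (BondConfig (Site 2)),
        (isoRectPercolation (π / 2)).real (quadCrossingEmb (isoRectDrawing (π / 2)) R δ \ G) ≤ ε ∧
        (isoRectPercolation (π / 2)).real
            ((quadCrossingEmb (isoRectDrawing (π / 2)) R δ)ᶜ \ B) ≤ ε ∧
        (∀ ω ω' : BondConfig (Site 2), ω' ∈ quadCrossingEmb (isoRectDrawing (π / 2)) R δ →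
          ω' ∈ G →
          LoopConfig.IsClose η (isoRectLoopConfig δ α ω) (isoRectLoopConfig δ (π / 2) ω') →
          ω ∈ quadCrossingEmb (isoRectDrawing α) R δ) ∧
        (∀ ω ω' : BondConfig (Site 2), ω' ∉ quadCrossingEmb (isoRectDrawing (π / 2)) R δ →
          ω' ∈ B →
          LoopConfig.IsClose η (isoRectLoopConfig δ α ω) (isoRectLoopConfig δ (π / 2) ω') →
          ω ∉ quadCrossingEmb (isoRectDrawing α) R δ))
    (h17 : dkkmo_theorem_1_7) :
    DKKMO2020_thm21_quadCrossingProb := by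
  intro R ε hε
  have hε2 : 0 < ε / 2 := by positivity
  obtain ⟨η, hη, δ₁, hδ₁, hH⟩ := H R (ε / 2) hε2
  obtain ⟨c, C, hc, hC, hcoup⟩ := h17.exists_coupling
  set ε' : ℝ := min η (ε / 2) with hε'def
  have hε' : 0 < ε' := lt_min hη hε2
  have hε'η : ε' ≤ η := min_le_left _ _
  have hε'2 : ε' ≤ ε / 2 := min_le_right _ _
  obtain ⟨δ₂, hδ₂, hsmall⟩ := exists_pos_forall_mul_rpow_lt hc hC hε'
  refine ⟨min δ₁ δ₂, lt_min hδ₁ hδ₂, fun α hα δ hδ => ?_⟩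
  have hα' : α ∈ Set.Ioo 0 π := ⟨hε.trans hα.1, by linarith [hα.2]⟩
  have hπ : π / 2 ∈ Set.Ioo 0 π := ⟨by positivity, by linarith [Real.pi_pos]⟩
  have hδ1 : δ ∈ Set.Ioo (0 : ℝ) δ₁ := ⟨hδ.1, hδ.2.trans_le (min_le_left _ _)⟩
  have hδ2 : δ ∈ Set.Ioo (0 : ℝ) δ₂ := ⟨hδ.1, hδ.2.trans_le (min_le_right _ _)⟩
  obtain ⟨P, h1, h2, hP⟩ := hcoup α hα' δ hδ.1
  obtain ⟨G, B, hG, hB, htr₁, htr₂⟩ := hH α hα' δ hδ1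
  haveI : IsProbabilityMeasure P := isProbabilityMeasure_of_map_fst h1
  have hδpos : 0 < δ := hδ.1
  have hCδ : 0 < C * δ ^ c := by positivity
  have hCδη : C * δ ^ c ≤ η := ((hsmall δ hδ2).le).trans hε'η
  set Cl : Set (BondConfig (Site 2) × BondConfig (Site 2)) :=
    {p | LoopConfig.IsClose (C * δ ^ c) (isoRectLoopConfig δ α p.1)
      (isoRectLoopConfig δ (π / 2) p.2)} with hCldef
  have hCl : P.real Clᶜ ≤ ε / 2 := by
    have hlt : P.real Clᶜ < C * δ ^ c := by
      have : Clᶜ = {p | ¬ LoopConfig.IsClose (C * δ ^ c) (isoRectLoopConfig δ α p.1)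
          (isoRectLoopConfig δ (π / 2) p.2)} := rfl
      rw [measureReal_def, this]
      exact ENNReal.toReal_lt_of_lt_ofReal hP
    exact (hlt.le.trans (hsmall δ hδ2).le).trans hε'2
  have key := abs_measureReal_sub_le_of_transfer P h1 h2
    (measurableSet_quadCrossingEmb_isoRectDrawing hα' R hδ.1)
    (measurableSet_quadCrossingEmb_isoRectDrawing hπ R hδ.1) Cl G B hG hB hCl
    (fun p hp h2' hG' => htr₁ p.1 p.2 h2' hG' (LoopConfig.IsClose.mono hCδ hCδη hp))
    (fun p hp h2' hB' => htr₂ p.1 p.2 h2' hB' (LoopConfig.IsClose.mono hCδ hCδη hp))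
  rw [prodBernoulli_isoRectCriticalProb, prodBernoulli_isoRectCriticalProb]
  calc _ ≤ max (ε / 2) (ε / 2) + ε / 2 := key
    _ = ε := by rw [max_self]; ring

end Literature.Probability.Percolation

end
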